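import Mathlib
import HarnessLib
import Literature.Analysis.FluidPDE.SelfSimilar
import Literature.Analysis.FluidPDE.VectorCalculus
import Literature.Analysis.FluidPDE.FlatSwirlGauge
import Literature.Analysis.FluidPDE.NSViscosityRescaling
import Literature.Analysis.FluidPDE.SelfSimilarProofs
import Summits.NavierStokesRegularity.NavierStokesRegularity.Theorems.HalfSpaceWindowDoorCirculationCarryingRigidityDefs
import Summits.NavierStokesRegularity.NavierStokesRegularity.Theorems.HalfSpaceWindowDoorCirculationCarryingRigidityPlaneFluxHeightWindow

/-!
# Route `HalfSpaceWindowDoor`, crux `CirculationCarryingRigidity` (stmt-NavierStokesRegularity-25311) — TIGHTNESS: the open stub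
# `HemisphereLiouvilleE3` is FALSE WITHOUT ITS DYNAMICAL (Oseen–Duhamel) HYPOTHESIS

`HemisphereLiouvilleE3` (≡ `StubLayerExclusion` ≡ `NoExtremalHemisphereProfile`) says: a profile with Type-I time rate, continuous on
the open slab, satisfying the unit-viscosity Oseen–Duhamel identity, divergence-free, with `⟪curl v, e₃⟫ ≥ 0` everywhere, has
`⟪curl v, e₃⟫ ≡ 0`.  This file shows that the DYNAMICS is load-bearing: dropping the Oseen–Duhamel identity (keeping Type-I rate,
continuity, divergence-freeness and the closed-hemisphere sign) the statement is FALSE, by the explicit kinematic witness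

  `v(t,x) = (−t)^{−1/2} V(x/√(−t))`,   `V(ξ) = (2/(1 + ξ₀² + ξ₁²)) (−ξ₁, ξ₀, 0)`

(a self-similarly collapsing planar vortex: `V` smooth, `‖V‖ ≤ 1`, `div V = 0`, `⟪curl V, e₃⟫ = 4/(1+ξ₀²+ξ₁²)² > 0`), so
`hemisphereLiouvilleE3_false_without_mild`.  (It is of course not a Navier–Stokes solution; no refutation of the stub is claimed.)

* `witnessV`, its derivative (`hasFDerivAt_witnessV`), `norm_witnessV_le_one`, `isDivFree_witnessV`, `inner_curl_witnessV_e3`;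
* `hemisphereLiouvilleE3_false_without_mild` — the statement of `HemisphereLiouvilleE3` with the Oseen–Duhamel hypothesis deleted
  is false.

Seat ns-hsw-p1 g2 (LEAD of 25311, cell pub-ns-dss; cdisprove-genre hygiene «which hypotheses any proof must use»).  WHAT THIS IS
NOT: not a refutation of the stub or of anything about Navier–Stokes; a kinematic witness; helper `--supports` 25311.
-/

noncomputable section

-- the summit and its single sub-problem share the name (CONVENTIONS §1), as in every Theorems file
set_option linter.dupNamespace false

namespace Summit.NavierStokesRegularity.NavierStokesRegularity.Theorems.HalfSpaceWindowDoorCirculationCarryingRigidityTightness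

open Set Function Filter Topology
open scoped RealInnerProductSpace InnerProductSpace
open Literature.Analysis Literature.Analysis.FluidPDE
open Summit.NavierStokesRegularity.NavierStokesRegularity.Theorems.HalfSpaceWindowDoorCirculationCarryingRigidityDefs
open Summit.NavierStokesRegularity.NavierStokesRegularity.Theorems.HalfSpaceWindowDoorCirculationCarryingRigidityPlaneFluxHeightWindow
  (inner_e3_eq_apply)

/-! ### The planar rotation and the witness profile -/

/-- The horizontal rotation `J x = (−x₁, x₀, 0)` as a continuous linear map. -/
def rotJ : EuclideanSpace ℝ (Fin 3) →L[ℝ] EuclideanSpace ℝ (Fin 3) :=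
  (EuclideanSpace.proj (0 : Fin 3) : EuclideanSpace ℝ (Fin 3) →L[ℝ] ℝ).smulRight (EuclideanSpace.single 1 (1 : ℝ)) -
    (EuclideanSpace.proj (1 : Fin 3) : EuclideanSpace ℝ (Fin 3) →L[ℝ] ℝ).smulRight (EuclideanSpace.single 0 (1 : ℝ))

/-- Coordinates of `J x`. -/
theorem rotJ_apply (x : EuclideanSpace ℝ (Fin 3)) :
    rotJ x = WithLp.toLp 2 ![-(x 1), x 0, 0] := by
  ext i
  fin_cases i <;> simp [rotJ]

/-- `(Jx)₀ = −x₁`. -/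
theorem rotJ_apply_zero (x : EuclideanSpace ℝ (Fin 3)) : rotJ x 0 = -(x 1) := by rw [rotJ_apply]; simp
/-- `(Jx)₁ = x₀`. -/
theorem rotJ_apply_one (x : EuclideanSpace ℝ (Fin 3)) : rotJ x 1 = x 0 := by rw [rotJ_apply]; simp
/-- `(Jx)₂ = 0`. -/
theorem rotJ_apply_two (x : EuclideanSpace ℝ (Fin 3)) : rotJ x 2 = 0 := by rw [rotJ_apply]; simp

/-- `‖J x‖² = x₀² + x₁²`. -/
theorem norm_rotJ_sq (x : EuclideanSpace ℝ (Fin 3)) : ‖rotJ x‖ ^ 2 = x 0 ^ 2 + x 1 ^ 2 := by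
  rw [EuclideanSpace.norm_sq_eq, Fin.sum_univ_three, rotJ_apply_zero, rotJ_apply_one, rotJ_apply_two]
  simp only [Real.norm_eq_abs, sq_abs]
  ring

/-- The scalar factor `φ(x) = 2/(1 + ‖Jx‖²)`. -/
def phi (x : EuclideanSpace ℝ (Fin 3)) : ℝ := 2 / (1 + ‖rotJ x‖ ^ 2)

/-- THE WITNESS PROFILE `V(ξ) = φ(ξ) • Jξ = 2(−ξ₁, ξ₀, 0)/(1+ξ₀²+ξ₁²)`. -/
def witnessV (x : EuclideanSpace ℝ (Fin 3)) : EuclideanSpace ℝ (Fin 3) := phi x • rotJ x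

/-- `0 < 1 + ‖Jx‖²`. -/
theorem one_add_pos (x : EuclideanSpace ℝ (Fin 3)) : 0 < 1 + ‖rotJ x‖ ^ 2 := by positivity

/-- Derivative of `φ`: `Dφ(x) h = −(4/(1+‖Jx‖²)²) ⟪Jx, Jh⟫`. -/
theorem hasFDerivAt_phi (x : EuclideanSpace ℝ (Fin 3)) :
    HasFDerivAt phi ((-(4 / (1 + ‖rotJ x‖ ^ 2) ^ 2)) • (innerSL ℝ (rotJ x)).comp rotJ) x := by
  have hpos := one_add_pos x
  -- `N y = ‖J y‖²`, `φ = g ∘ N` with `g r = 2 (1+r)⁻¹`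
  have hN : HasFDerivAt (fun y : EuclideanSpace ℝ (Fin 3) => ‖rotJ y‖ ^ 2) ((2 : ℕ) • (innerSL ℝ (rotJ x)).comp rotJ) x := by
    have := rotJ.hasFDerivAt (x := x) |>.norm_sq
    simpa using this
  have hg : HasDerivAt (fun r : ℝ => 2 * (1 + r)⁻¹) (2 * (-(1 : ℝ) / (1 + ‖rotJ x‖ ^ 2) ^ 2)) (‖rotJ x‖ ^ 2) := by
    have h1 : HasDerivAt (fun r : ℝ => 1 + r) 1 (‖rotJ x‖ ^ 2) := by
      simpa using (hasDerivAt_id (‖rotJ x‖ ^ 2)).const_add 1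
    exact (h1.inv hpos.ne').const_mul 2
  have hcomp := hg.comp_hasFDerivAt x hN
  have hfun : ((fun r : ℝ => 2 * (1 + r)⁻¹) ∘ fun y : EuclideanSpace ℝ (Fin 3) => ‖rotJ y‖ ^ 2) = phi := by
    funext y; simp [phi, div_eq_mul_inv]
  rw [hfun] at hcomp
  refine hcomp.congr_fderiv ?_
  ext h
  simp only [two_nsmul, FunLike.coe_smul, Pi.smul_apply, FunLike.coe_add, Pi.add_apply, ContinuousLinearMap.comp_apply,
    innerSL_apply_apply, smul_eq_mul]
  field_simp
  ring

/-- **Derivative of the witness**: `DV(x) h = φ(x) Jh + (Dφ(x) h) Jx`. -/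
theorem hasFDerivAt_witnessV (x : EuclideanSpace ℝ (Fin 3)) :
    HasFDerivAt witnessV (phi x • rotJ + ((-(4 / (1 + ‖rotJ x‖ ^ 2) ^ 2)) • (innerSL ℝ (rotJ x)).comp rotJ).smulRight (rotJ x)) x :=
  (hasFDerivAt_phi x).smul rotJ.hasFDerivAt

/-- `V` is differentiable. -/
theorem differentiable_witnessV : Differentiable ℝ witnessV := fun x => (hasFDerivAt_witnessV x).differentiableAt

/-- `V` is `C¹`. -/
theorem contDiff_witnessV : ContDiff ℝ 1 witnessV := by
  have hφ : ContDiff ℝ 1 phi := by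
    refine ContDiff.div contDiff_const (contDiff_const.add ((contDiff_norm_sq ℝ).comp rotJ.contDiff)) fun x => (one_add_pos x).ne'
  exact hφ.smul rotJ.contDiff

/-- `V` is continuous. -/
theorem continuous_witnessV : Continuous witnessV := contDiff_witnessV.continuous

/-- The derivative applied: `DV(x) h = φ(x) Jh − (4⟪Jx,Jh⟫/(1+‖Jx‖²)²) Jx`. -/
theorem fderiv_witnessV_apply (x h : EuclideanSpace ℝ (Fin 3)) :
    fderiv ℝ witnessV x h = phi x • rotJ h + (-(4 / (1 + ‖rotJ x‖ ^ 2) ^ 2) * ⟪rotJ x, rotJ h⟫) • rotJ x := by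
  rw [(hasFDerivAt_witnessV x).fderiv]
  simp [ContinuousLinearMap.smulRight_apply, innerSL_apply_apply]

/-- `⟪Jx, Je₀⟫ = x₀`, `⟪Jx, Je₁⟫ = x₁`. -/
theorem inner_rotJ_single_zero (x : EuclideanSpace ℝ (Fin 3)) : ⟪rotJ x, rotJ (EuclideanSpace.single 0 1)⟫ = x 0 := by
  rw [rotJ_apply x, rotJ_apply]
  simp [EuclideanSpace.inner_eq_star_dotProduct, Fin.sum_univ_three, dotProduct]

/-- `⟪Jx, Je₁⟫ = x₁`. -/
theorem inner_rotJ_single_one (x : EuclideanSpace ℝ (Fin 3)) : ⟪rotJ x, rotJ (EuclideanSpace.single 1 1)⟫ = x 1 := by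
  rw [rotJ_apply x, rotJ_apply]
  simp [EuclideanSpace.inner_eq_star_dotProduct, Fin.sum_univ_three, dotProduct]

/-- `‖V(x)‖ ≤ 1` (`2r/(1+r²) ≤ 1`). -/
theorem norm_witnessV_le_one (x : EuclideanSpace ℝ (Fin 3)) : ‖witnessV x‖ ≤ 1 := by
  rw [witnessV, norm_smul, phi, Real.norm_eq_abs, abs_of_pos (div_pos two_pos (one_add_pos x))]
  rw [div_mul_eq_mul_div, div_le_one (one_add_pos x)]
  nlinarith [sq_nonneg (‖rotJ x‖ - 1), norm_nonneg (rotJ x)]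

/-- `div V = 0`. -/
theorem isDivFree_witnessV : VectorCalculus.IsDivFree witnessV := by
  intro x
  rw [divergence_eq_sum_three, fderiv_witnessV_apply, fderiv_witnessV_apply, fderiv_witnessV_apply,
    inner_rotJ_single_zero, inner_rotJ_single_one]
  have h2 : ⟪rotJ x, rotJ (EuclideanSpace.single 2 1)⟫ = 0 := by
    rw [rotJ_apply x, rotJ_apply]; simp [EuclideanSpace.inner_eq_star_dotProduct, Fin.sum_univ_three, dotProduct]
  rw [h2]
  simp only [PiLp.add_apply, PiLp.smul_apply, smul_eq_mul, rotJ_apply_zero, rotJ_apply_one, rotJ_apply_two]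
  simp
  ring

/-- **`⟪curl V(x), e₃⟫ = 4/(1+x₀²+x₁²)²`** (`> 0`). -/
theorem inner_curl_witnessV_e3 (x : EuclideanSpace ℝ (Fin 3)) :
    ⟪curl witnessV x, e3⟫ = 4 / (1 + (x 0 ^ 2 + x 1 ^ 2)) ^ 2 := by
  rw [inner_e3_eq_apply, curl_apply_two, fderiv_witnessV_apply, fderiv_witnessV_apply, inner_rotJ_single_zero,
    inner_rotJ_single_one]
  simp only [PiLp.add_apply, PiLp.smul_apply, smul_eq_mul, rotJ_apply_zero, rotJ_apply_one, phi, norm_rotJ_sq]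
  simp
  have hpos : 0 < 1 + (x 0 ^ 2 + x 1 ^ 2) := by positivity
  field_simp
  ring

/-- `⟪curl V, e₃⟫ > 0`. -/
theorem inner_curl_witnessV_e3_pos (x : EuclideanSpace ℝ (Fin 3)) : 0 < ⟪curl witnessV x, e3⟫ := by
  rw [inner_curl_witnessV_e3]; positivity

/-! ### The self-similar witness and the tightness statement -/

/-- THE WITNESS `v(t,x) = (−t)^{−1/2} V(x/√(−t))` (for `t ≥ 0` the formula gives `0`, irrelevant). -/
def witness (t : ℝ) (x : EuclideanSpace ℝ (Fin 3)) : EuclideanSpace ℝ (Fin 3) :=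
  (Real.sqrt (-t))⁻¹ • witnessV ((Real.sqrt (-t))⁻¹ • x)

/-- The witness has Type-I time rate `1`. -/
theorem hasTypeITimeDecay_witness : HasTypeITimeDecay 1 witness := by
  intro t ht x
  have hs : 0 < Real.sqrt (-t) := Real.sqrt_pos.2 (neg_pos.2 ht)
  rw [witness, norm_smul, Real.norm_eq_abs, abs_of_pos (inv_pos.2 hs), one_div]
  exact mul_le_of_le_one_right (inv_pos.2 hs).le (norm_witnessV_le_one _)

/-- The witness is jointly continuous on the open lower slab. -/
theorem continuousOn_witness : ContinuousOn (uncurry witness) (Iio (0 : ℝ) ×ˢ univ) := by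
  have hc : ContinuousOn (fun p : ℝ × EuclideanSpace ℝ (Fin 3) => (Real.sqrt (-p.1))⁻¹) (Iio (0 : ℝ) ×ˢ univ) := by
    refine ContinuousOn.inv₀ ((Real.continuous_sqrt.comp continuous_fst.neg).continuousOn) fun p hp => ?_
    exact (Real.sqrt_pos.2 (neg_pos.2 (mem_prod.1 hp).1)).ne'
  have h : ContinuousOn (fun p : ℝ × EuclideanSpace ℝ (Fin 3) => (Real.sqrt (-p.1))⁻¹ • witnessV ((Real.sqrt (-p.1))⁻¹ • p.2))
      (Iio (0 : ℝ) ×ˢ univ) :=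
    hc.smul (continuous_witnessV.comp_continuousOn (hc.smul continuous_snd.continuousOn))
  exact h.congr fun p _ => rfl

/-- The witness has divergence-free slices. -/
theorem isDivFree_witness (t : ℝ) : VectorCalculus.IsDivFree (witness t) := by
  have h1 : VectorCalculus.IsDivFree fun x : EuclideanSpace ℝ (Fin 3) => witnessV ((Real.sqrt (-t))⁻¹ • x) :=
    isDivFree_witnessV.comp_smul _
  have hsm : Differentiable ℝ fun x : EuclideanSpace ℝ (Fin 3) => (Real.sqrt (-t))⁻¹ • x :=
    fun x => ((hasFDerivAt_id x).const_smul (Real.sqrt (-t))⁻¹).differentiableAt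
  have hd : Differentiable ℝ fun x : EuclideanSpace ℝ (Fin 3) => witnessV ((Real.sqrt (-t))⁻¹ • x) :=
    differentiable_witnessV.comp hsm
  exact VectorCalculus.IsDivFree.const_smul hd h1 _

/-- The `e₃`-vorticity of the witness: `⟪curl v(t)(x), e₃⟫ = (−t)⁻¹ ⟪curl V(x/√(−t)), e₃⟫ > 0` for `t < 0`. -/
theorem inner_curl_witness_e3 (t : ℝ) (x : EuclideanSpace ℝ (Fin 3)) :
    ⟪curl (witness t) x, e3⟫ = ((Real.sqrt (-t))⁻¹ * (Real.sqrt (-t))⁻¹) * ⟪curl witnessV ((Real.sqrt (-t))⁻¹ • x), e3⟫ := by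
  have h : witness t = fun y => (Real.sqrt (-t))⁻¹ • witnessV ((Real.sqrt (-t))⁻¹ • y) := rfl
  rw [h, curl_smul_comp_smul, inner_smul_left]
  simp

/-- The witness is closed-hemisphere, strictly: `⟪curl v(t), e₃⟫ > 0` for `t < 0`. -/
theorem inner_curl_witness_e3_pos {t : ℝ} (ht : t < 0) (x : EuclideanSpace ℝ (Fin 3)) : 0 < ⟪curl (witness t) x, e3⟫ := by
  rw [inner_curl_witness_e3 t]
  have hs : 0 < Real.sqrt (-t) := Real.sqrt_pos.2 (neg_pos.2 ht)
  exact mul_pos (mul_pos (inv_pos.2 hs) (inv_pos.2 hs)) (inner_curl_witnessV_e3_pos _)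

/-- **TIGHTNESS: `HemisphereLiouvilleE3` WITHOUT THE OSEEN–DUHAMEL HYPOTHESIS IS FALSE.**  The closed-hemisphere Liouville
statement for fields with Type-I time rate, continuity on the open slab, divergence-free slices and `⟪curl v, e₃⟫ ≥ 0` — but
WITHOUT the unit-viscosity Oseen–Duhamel identity — fails: the self-similarly collapsing planar vortex `witness` satisfies every
remaining hypothesis and has `⟪curl v, e₃⟫ > 0` everywhere.  Hence any proof of the stub must use the Navier–Stokes dynamics. -/
theorem hemisphereLiouvilleE3_false_without_mild :
    ¬ (∀ (C : ℝ) (v : ℝ → EuclideanSpace ℝ (Fin 3) → EuclideanSpace ℝ (Fin 3)),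
        Literature.Analysis.FluidPDE.HasTypeITimeDecay C v →
        ContinuousOn (Function.uncurry v) (Set.Iio (0 : ℝ) ×ˢ Set.univ) →
        (∀ t < 0, Literature.Analysis.FluidPDE.VectorCalculus.IsDivFree (v t)) →
        (∀ s < 0, ∀ y, 0 ≤ ⟪Literature.Analysis.FluidPDE.curl (v s) y, e3⟫_ℝ) →
        ∀ s < 0, ∀ y, ⟪Literature.Analysis.FluidPDE.curl (v s) y, e3⟫_ℝ = 0) := by
  intro h
  have h0 := h 1 witness hasTypeITimeDecay_witness continuousOn_witness (fun t _ => isDivFree_witness t)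
    (fun s hs y => (inner_curl_witness_e3_pos hs y).le) (-1) (by norm_num) 0
  exact (inner_curl_witness_e3_pos (by norm_num : (-1 : ℝ) < 0) 0).ne' h0

end Summit.NavierStokesRegularity.NavierStokesRegularity.Theorems.HalfSpaceWindowDoorCirculationCarryingRigidityTightness

end
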